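import Summits.Ventures.HSemireg.WedgeHankelRecurrenceGaussGegenbauerChebyshevNodes

/-!
# Venture HSemireg — **GEGENBAUER NODES VERSUS SECOND-KIND GAUSS–CHEBYSHEV NODES FOR `λ ≥ 1`** (complement of N448): now `1∕4 − b_{n+1}(λ) = λ(λ−1)∕(4(n+λ)(n+1+λ)) ∈ [0, (λ−1)∕(4(1+λ))]`,
# `(√(1∕4) − √b)² ≤ 4(1∕4 − b)²` for `0 ≤ b ≤ 1∕4`, and Hoffman–Wielandt (N417) gives for EVERY `t`: **`Σ_{k≤t} (cos((k'+1)π∕(t+2)) − x_k)² ≤ (λ−1)²∕(2(1+λ))`**; together with N448, the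
# Gegenbauer nodes depend Lipschitz-continuously (in `ℓ²`, uniformly in the degree) on `λ` at `λ = 1`

HONEST FRAMING. Part of the Lean index of the computation cell `pub-hsemireg` (seat p10 gen 47, Sunday typer «UNIFORM-IN-n»).  Real finite sums, `Real.cos`, `Real.sqrt` only; no variety, no
cohomology theory, no sheaf, no Ext group and no semiregularity map is constructed here; nothing here says that HC / HC_CM / HC_AV holds; no Literature fact (unproved `Prop`) is declared or used.
Custodian versions as in `WedgeHankelSiegelIdeal` (1/3).
SOURCES (cited).  A. J. Hoffman, H. W. Wielandt, Duke Math. J. 20 (1953) 37–39; G. H. Golub, J. H. Welsch, Math. Comp. 23 (1969) 221–230; W. Gautschi, *Orthogonal Polynomials: Computation and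
Approximation* (2004), §3.1; G. Szegő, *Orthogonal Polynomials*, (4.7.17), §6.21.  The uniform bound is the COROLLARY typed here of N417.
PROOF TYPED HERE.  As N448 with `u = 1∕4 − b ≥ 0`: N448 `gegenbauer_coeff_sub_quarter`, `sum_inv_mul_succ_shift`; the scalar estimate `(½ − √b)² ≤ 4(¼ − b)²` (`½ − √b ≤ 2(¼ − b)` as `√b + ½ ≥ ½`).
DEDUP DISCLOSURE (`rg -n -i 'gegenbauer.*nodes_hoff' Summits/Ventures/HSemireg`, 2026-09-04): N448 (`0 < λ ≤ 1`); 0 hits for the 3 names below.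

WHAT IS IN THE TREE.  N417 `hoffman_wielandt_recurrence`; N448 (`λ ≤ 1`) and its scalar lemmas; §1125 Chebyshev-`U` recurrence facts.
THIS FILE (namespace `Summit.Ventures.HSemireg.Wedge.HankelOuter` continued; CHAINED on N448; 0 definitions):
* §1214 `sqrt_quarter_sub_sqrt_sq_le_of_le` (`0 ≤ b ≤ 1∕4`), **`gegenbauer_chebyshevU_nodes_hoffman_wielandt_of_one_le`** (`≤ (λ−1)²∕(2(1+λ))`), `gegenbauer_chebyshevU_nodes_sub_sq_le_of_one_le`.
CAVEATS.  `λ ≥ 1`; not sharp.  The Gegenbauer zeros enter as any increasing `x` with the product representation.  Nothing Ext-side.  New names only.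
-/

open Module Polynomial Real
open scoped Matrix Polynomial

namespace Summit.Ventures.HSemireg.Wedge.HankelOuter

/-! ## §1214. Gegenbauer versus second-kind Chebyshev nodes, `λ ≥ 1` -/

/-- `(√(1∕4) − √b)² ≤ 4(1∕4 − b)²` for `0 ≤ b ≤ 1∕4`. [bookkeeping; this file, §1214] -/
theorem sqrt_quarter_sub_sqrt_sq_le_of_le {u : ℝ} (hu0 : 0 ≤ u) (hu : u ≤ 1 / 4) : (Real.sqrt (1 / 4) - Real.sqrt u) ^ 2 ≤ 4 * (1 / 4 - u) ^ 2 := by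
  have h4 : Real.sqrt (1 / 4) = 1 / 2 := by rw [show (1 / 4 : ℝ) = (1 / 2) ^ 2 by norm_num, Real.sqrt_sq (by norm_num)]
  have hshalf : Real.sqrt u ≤ 1 / 2 := by rw [← h4]; exact Real.sqrt_le_sqrt hu
  set s : ℝ := Real.sqrt u with hs
  have hs0 : 0 ≤ s := Real.sqrt_nonneg _
  have hs2 : s ^ 2 = u := Real.sq_sqrt hu0
  rw [h4, ← hs2]
  have ha : 0 ≤ 1 / 2 - s := by linarith
  have hb : 1 / 2 - s ≤ 2 * (1 / 4 - s ^ 2) := by nlinarith [mul_nonneg ha hs0]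
  calc (1 / 2 - s) ^ 2 ≤ (2 * (1 / 4 - s ^ 2)) ^ 2 := pow_le_pow_left₀ ha hb 2
    _ = 4 * (1 / 4 - s ^ 2) ^ 2 := by ring

/-- **`Σ_k (y_k − x_k)² ≤ (λ−1)²∕(2(1+λ))`** for the increasing zeros `x` of the Gegenbauer polynomial `C^{(λ)}_{t+1}` (`λ ≥ 1`, chapter recurrence) and the increasing zeros `y` of `U_{t+1}`,
every `t`. [corollary of Hoffman–Wielandt 1953 via Golub–Welsch 1969; Gautschi §3.1; Szegő §6.21; this file, §1214] -/
theorem gegenbauer_chebyshevU_nodes_hoffman_wielandt_of_one_le {q : ℕ → ℝ[X]} {a b : ℕ → ℝ} {lam : ℝ} (hq0 : q 0 = 1) (hq1 : q 1 = Polynomial.X - C (a 0))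
    (hrec : ∀ n, q (n + 2) = (Polynomial.X - C (a (n + 1))) * q (n + 1) - C (b (n + 1)) * q n) (ha : ∀ n, a n = 0)
    (hb : ∀ n, b (n + 1) = ((n : ℝ) + 1) * ((n : ℝ) + 2 * lam) / (4 * ((n : ℝ) + 1 + lam) * ((n : ℝ) + lam))) (hlam1 : 1 ≤ lam) (hb0 : 0 < b 0)
    {t : ℕ} {x : Fin (t + 1) → ℝ} (hx : StrictMono x) (hxq : q (t + 1) = ∏ k, (Polynomial.X - C (x k))) :
    ∑ k, (cos ((((Fin.rev k : Fin (t + 1)) : ℝ) + 1) * π / ((t : ℝ) + 2)) - x k) ^ 2 ≤ (lam - 1) ^ 2 / (2 * (1 + lam)) := by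
  have hlam : 0 < lam := by linarith
  obtain ⟨q', hq0', hq1', hrec'⟩ := recurrence_of_coefficients (fun _ => (0 : ℝ)) (fun _ => (1 / 4 : ℝ))
  have hyq := chebyshevU_recurrence_eq_prod (q := q') (a := fun _ => (0 : ℝ)) (b := fun _ => (1 / 4 : ℝ)) hq0' hq1' hrec' (fun _ => rfl) (fun _ => rfl) t
  have hsub : ∀ n : ℕ, 1 / 4 - b (n + 1) = lam * (lam - 1) / (4 * ((n : ℝ) + lam) * ((n : ℝ) + 1 + lam)) := fun n => by
    linear_combination -(gegenbauer_coeff_sub_quarter hb hlam n)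
  have h1l : 0 ≤ lam - 1 := by linarith
  have hnum : 0 ≤ lam * (lam - 1) := mul_nonneg hlam.le h1l
  have hnn : ∀ n : ℕ, 0 ≤ 1 / 4 - b (n + 1) := fun n => by
    rw [hsub]
    have h0 : (0 : ℝ) ≤ n := Nat.cast_nonneg n
    exact div_nonneg hnum (by positivity)
  have hle : ∀ n : ℕ, 1 / 4 - b (n + 1) ≤ (lam - 1) / (4 * (1 + lam)) := fun n => by
    rw [hsub]
    have h0 : (0 : ℝ) ≤ n := Nat.cast_nonneg n
    calc lam * (lam - 1) / (4 * ((n : ℝ) + lam) * ((n : ℝ) + 1 + lam)) ≤ lam * (lam - 1) / (4 * lam * (1 + lam)) :=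
          div_le_div_of_nonneg_left hnum (by positivity) (by nlinarith)
      _ = (lam - 1) / (4 * (1 + lam)) := by field_simp
  have hbpos : ∀ j, 0 < b j := fun j => by
    rcases j with _ | n
    · exact hb0
    · rw [hb]; have h0 : (0 : ℝ) ≤ n := Nat.cast_nonneg n; positivity
  have h := hoffman_wielandt_recurrence (q := q) (q' := q') (a := a) (a' := fun _ => (0 : ℝ)) (b := b) (b' := fun _ => (1 / 4 : ℝ))
    hq0 hq1 hrec hq0' hq1' hrec' hbpos (fun _ => by norm_num) hx hxq (chebyshevU_nodes_strictMono t) hyq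
  refine h.trans ?_
  simp only [ha, sub_self, zero_pow two_ne_zero, Finset.sum_const_zero, zero_add]
  have ht : (0 : ℝ) ≤ t := Nat.cast_nonneg t
  have hsum : ∑ i ∈ Finset.range t, (1 / 4 - b (i + 1)) ≤ (lam - 1) / 4 := by
    rw [Finset.sum_congr rfl fun i _ => (hsub i).trans (show lam * (lam - 1) / (4 * ((i : ℝ) + lam) * ((i : ℝ) + 1 + lam)) =
      lam * (lam - 1) / 4 * (1 / (((i : ℝ) + lam) * ((i : ℝ) + 1 + lam))) by
        have h0 : (0 : ℝ) ≤ i := Nat.cast_nonneg i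
        field_simp), ← Finset.mul_sum, sum_inv_mul_succ_shift hlam t]
    have hpos : 0 ≤ 1 / ((t : ℝ) + lam) := by positivity
    have hfrac : 1 / lam - 1 / ((t : ℝ) + lam) ≤ 1 / lam := by linarith
    calc lam * (lam - 1) / 4 * (1 / lam - 1 / ((t : ℝ) + lam)) ≤ lam * (lam - 1) / 4 * (1 / lam) :=
          mul_le_mul_of_nonneg_left hfrac (div_nonneg hnum (by norm_num))
      _ = (lam - 1) / 4 := by field_simp
  have hc : 0 ≤ (lam - 1) / (1 + lam) := div_nonneg h1l (by positivity)
  calc 2 * ∑ i ∈ Finset.range t, (Real.sqrt (1 / 4) - Real.sqrt (b (i + 1))) ^ 2 ≤ 2 * ∑ i ∈ Finset.range t, 4 * (1 / 4 - b (i + 1)) ^ 2 := by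
        refine mul_le_mul_of_nonneg_left (Finset.sum_le_sum fun i _ => ?_) (by norm_num)
        exact sqrt_quarter_sub_sqrt_sq_le_of_le (u := b (i + 1)) (hbpos (i + 1)).le (by linarith [hnn i])
    _ ≤ 2 * ∑ i ∈ Finset.range t, ((lam - 1) / (1 + lam) * (1 / 4 - b (i + 1))) := by
        refine mul_le_mul_of_nonneg_left (Finset.sum_le_sum fun i _ => ?_) (by norm_num)
        have h3 := mul_le_mul_of_nonneg_right (hle i) (hnn i)
        calc 4 * (1 / 4 - b (i + 1)) ^ 2 = 4 * ((1 / 4 - b (i + 1)) * (1 / 4 - b (i + 1))) := by ring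
          _ ≤ 4 * ((lam - 1) / (4 * (1 + lam)) * (1 / 4 - b (i + 1))) := mul_le_mul_of_nonneg_left h3 (by norm_num)
          _ = (lam - 1) / (1 + lam) * (1 / 4 - b (i + 1)) := by field_simp
    _ = 2 * ((lam - 1) / (1 + lam) * ∑ i ∈ Finset.range t, (1 / 4 - b (i + 1))) := by rw [← Finset.mul_sum]
    _ ≤ 2 * ((lam - 1) / (1 + lam) * ((lam - 1) / 4)) := mul_le_mul_of_nonneg_left (mul_le_mul_of_nonneg_left hsum hc) (by norm_num)
    _ = (lam - 1) ^ 2 / (2 * (1 + lam)) := by field_simp; ring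

/-- **Each increasing-ordered pair of Gegenbauer (`λ ≥ 1`) and second-kind Gauss–Chebyshev nodes: `(y_k − x_k)² ≤ (λ−1)²∕(2(1+λ))`**, uniformly in the degree. [corollary; this file, §1214] -/
theorem gegenbauer_chebyshevU_nodes_sub_sq_le_of_one_le {q : ℕ → ℝ[X]} {a b : ℕ → ℝ} {lam : ℝ} (hq0 : q 0 = 1) (hq1 : q 1 = Polynomial.X - C (a 0))
    (hrec : ∀ n, q (n + 2) = (Polynomial.X - C (a (n + 1))) * q (n + 1) - C (b (n + 1)) * q n) (ha : ∀ n, a n = 0)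
    (hb : ∀ n, b (n + 1) = ((n : ℝ) + 1) * ((n : ℝ) + 2 * lam) / (4 * ((n : ℝ) + 1 + lam) * ((n : ℝ) + lam))) (hlam1 : 1 ≤ lam) (hb0 : 0 < b 0)
    {t : ℕ} {x : Fin (t + 1) → ℝ} (hx : StrictMono x) (hxq : q (t + 1) = ∏ k, (Polynomial.X - C (x k))) (k : Fin (t + 1)) :
    (cos ((((Fin.rev k : Fin (t + 1)) : ℝ) + 1) * π / ((t : ℝ) + 2)) - x k) ^ 2 ≤ (lam - 1) ^ 2 / (2 * (1 + lam)) :=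
  (Finset.single_le_sum (f := fun k : Fin (t + 1) => (cos ((((Fin.rev k : Fin (t + 1)) : ℝ) + 1) * π / ((t : ℝ) + 2)) - x k) ^ 2) (fun _ _ => sq_nonneg _)
    (Finset.mem_univ k)).trans (gegenbauer_chebyshevU_nodes_hoffman_wielandt_of_one_le hq0 hq1 hrec ha hb hlam1 hb0 hx hxq)

end Summit.Ventures.HSemireg.Wedge.HankelOuter
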